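import Summits.Ventures.PercRepro.GenQOpenLayers
import Summits.Ventures.PercRepro.GenQHypAddTwoD
import Summits.Ventures.PercRepro.GenQHypAddOneAll

/-!
# PercRepro — the `(7, 5)` layer `t = 4` in its three corners (night-4, gen 2)

`SevenFiveLayers` (`GenQOpenLayers.lean`) is the exact kernel gap of the first open row `(7, 5)`: on the rank-`5`
flats `G ∈ 𝔉_5` of simple matroids, the type-`2` balance for `g ≤ 10`, the type-`3` balance, and the type-`4`
balance.  This file cuts the type-`4` layer along the cover of `𝔉_5` into the three corners of the `(6, 4)` residue
of record, two of which are rank-`4` statements by `GenQHypAddOneAll` / `GenQHypAddTwoD`: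

* `SevenFiveCornerOne` — «hyperplane + one point»: on every rank-`4` set `H` of a simple matroid,
  `0 ≤ Σ_{B ∈ R_4(H)} (3/(2 + m(B)) − (7/6)·dem_4(B))` (`Jq_five_four_hyp_add_one_eq` turns it into the balance);
* `SevenFiveCornerTwo` — «hyperplane + two points»: `0 ≤ hypAddTwoProfile M τ a a′ 4 4` for every rank-`4` trace `τ`
  and two points off `cl(τ)` spanning rank `5` with it (`Jq_hyp_add_two_nonneg_of_profile`);
* `SevenFiveCornerThree` — the rest of `𝔉_5`: the type-`4` balance on the rank-`5` flats in `𝔉_5` with NO hyperplane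
  trace of `≥ g − 2` points (`¬ HypPlusLeTwo`);

and **`sevenFiveLayers_of_corners`**: the three corners, the type-`2` window and the type-`3` layer give
`SevenFiveLayers`, hence `RLS M 7 5` on every finite matroid (`rls_seven_five_of_corners`).  The case split
`hypPlusLeTwo_cases`: a flat `G` with two points `a, a′` whose removal leaves rank `≤ 4` is `H ∪ {a}` with `ρ(H) = 4`
(one point, or the other point inside `cl` of the rest) or `τ ∪ {a, a′}` with `ρ(τ) = 4`, `a, a′ ∉ cl(τ)`.
-/

namespace PercRepro.GenQ

open Finset ThmH PerFlat SixFour ThmN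

variable {α : Type*} [DecidableEq α] {M : Matroid α} [M.Finite]

/-- `G` has a hyperplane trace of at least `g − 2` points: two (possibly equal) points whose removal drops the rank. -/
def HypPlusLeTwo (M : Matroid α) [M.Finite] (G : Finset α) (q : ℕ) : Prop :=
  ∃ a ∈ G, ∃ a' ∈ G, M.eRk (((G.erase a).erase a' : Finset α) : Set α) + 1 ≤ (q : ℕ∞)

/-- **Corner (i)**: «hyperplane + one point» at `(7, 5)`, `t = 4`, as an inequality on the rank-`4` trace. -/
def SevenFiveCornerOne : Prop :=
  ∀ {β : Type} [DecidableEq β] (M : Matroid β) [M.Finite] (H : Finset β), Simple M → H ⊆ gr M →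
    M.eRk (H : Set β) = 4 → 0 ≤ ∑ B ∈ Rq M H 4, (3 / (2 + (mTr M B : ℚ)) - (7 / 6) * dem M H 4 B)

/-- **Corner (ii)**: «hyperplane + two points» at `(7, 5)`, `t = 4`, as the profile inequality of the trace. -/
def SevenFiveCornerTwo : Prop :=
  ∀ {β : Type} [DecidableEq β] (M : Matroid β) [M.Finite] (τ : Finset β) (a a' : β), Simple M → τ ⊆ gr M →
    a ∈ gr M → a' ∈ gr M → a ≠ a' → a ∉ τ → a' ∉ τ → a ∉ M.closure (τ : Set β) → a' ∉ M.closure (τ : Set β) →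
    M.eRk (τ : Set β) = 4 → M.eRk ((insert a (insert a' τ) : Finset β) : Set β) = 5 →
    0 ≤ hypAddTwoProfile M τ a a' 4 4

/-- **Corner (iii)**: the type-`4` balance on the rank-`5` flats in `𝔉_5` with no hyperplane trace of `≥ g − 2`
points. -/
def SevenFiveCornerThree : Prop :=
  ∀ {β : Type} [DecidableEq β] (M : Matroid β) [M.Finite] (G : Finset β), Simple M → G ∈ flatsQ M 5 →
    TwoHyp M G 5 → ¬ HypPlusLeTwo M G 5 → 0 ≤ Jq M G 5 4

/-- The type-`2` window and the type-`3` layer of `(7, 5)`. -/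
def SevenFiveLowLayers : Prop :=
  ∀ {β : Type} [DecidableEq β] (M : Matroid β) [M.Finite] (G : Finset β), Simple M → G ∈ flatsQ M 5 →
    TwoHyp M G 5 → (G.card ≤ 10 → 0 ≤ Jq M G 5 2) ∧ 0 ≤ Jq M G 5 3

/-- A rank-`5` set minus two points has rank `≥ 3`. -/
theorem eRk_erase_erase_ge {G : Finset α} {a a' : α} (hr : M.eRk (G : Set α) = 5) :
    (3 : ℕ∞) ≤ M.eRk (((G.erase a).erase a' : Finset α) : Set α) := by
  have h1 := M.eRk_insert_le_add_one a (((G.erase a) : Finset α) : Set α)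
  have h2 := M.eRk_insert_le_add_one a' (((G.erase a).erase a' : Finset α) : Set α)
  rw [← Finset.coe_insert] at h1 h2
  by_cases haG : a ∈ G
  · rw [Finset.insert_erase haG, hr] at h1
    by_cases ha'G : a' ∈ G.erase a
    · rw [Finset.insert_erase ha'G] at h2
      obtain ⟨k, hk, -⟩ := eRk_eq_nat M ((G.erase a).erase a')
      rw [hk] at h2 ⊢
      have h3 : M.eRk (((G.erase a) : Finset α) : Set α) ≤ (k : ℕ∞) + 1 := h2
      have h4 : (5 : ℕ∞) ≤ (k : ℕ∞) + 1 + 1 := h1.trans (by gcongr)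
      have h5 : ((5 : ℕ) : ℕ∞) ≤ ((k + 2 : ℕ) : ℕ∞) := by push_cast; exact h4
      have := (Nat.cast_le (α := ℕ∞)).1 h5
      exact_mod_cast (by omega : 3 ≤ k)
    · rw [Finset.erase_eq_of_notMem ha'G]
      obtain ⟨k, hk, -⟩ := eRk_eq_nat M (G.erase a)
      rw [hk] at h1 ⊢
      have h5 : ((5 : ℕ) : ℕ∞) ≤ ((k + 1 : ℕ) : ℕ∞) := by push_cast; exact h1
      have := (Nat.cast_le (α := ℕ∞)).1 h5
      exact_mod_cast (by omega : 3 ≤ k)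
  · rw [Finset.erase_eq_of_notMem haG] at h2 ⊢
    by_cases ha'G : a' ∈ G
    · rw [Finset.insert_erase ha'G, hr] at h2
      obtain ⟨k, hk, -⟩ := eRk_eq_nat M (G.erase a')
      rw [hk] at h2 ⊢
      have h5 : ((5 : ℕ) : ℕ∞) ≤ ((k + 1 : ℕ) : ℕ∞) := by push_cast; exact h2
      have := (Nat.cast_le (α := ℕ∞)).1 h5
      exact_mod_cast (by omega : 3 ≤ k)
    · rw [Finset.erase_eq_of_notMem ha'G, hr]
      norm_num

/-- A point whose removal drops the rank lies off the closure of the rest. -/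
theorem notMem_closure_erase_of_eRk_lt {G : Finset α} {a : α} (ha : a ∈ gr M)
    (hlt : M.eRk ((G.erase a : Finset α) : Set α) < M.eRk (G : Set α)) :
    a ∉ M.closure ((G.erase a : Finset α) : Set α) := by
  intro hmem
  have h := mem_closure_of_eRk_insert_le (M := M) (X := G.erase a) (a := a) ha
  by_cases haG : a ∈ G
  · have : M.eRk ((insert a (G.erase a) : Finset α) : Set α) = M.eRk ((G.erase a : Finset α) : Set α) := by
      rw [Finset.coe_insert, ← M.eRk_closure_eq (insert a _), Matroid.closure_insert_eq_of_mem_closure hmem,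
        M.eRk_closure_eq]
    rw [Finset.insert_erase haG] at this
    rw [this] at hlt
    exact lt_irrefl _ hlt
  · rw [Finset.erase_eq_of_notMem haG] at hlt
    exact lt_irrefl _ hlt

/-- **The case split** for a rank-`5` set with a hyperplane trace of `≥ g − 2` points. -/
theorem hypPlusLeTwo_cases {G : Finset α} (hr : M.eRk (G : Set α) = 5) (h : HypPlusLeTwo M G 5) :
    (∃ a ∈ G, M.eRk ((G.erase a : Finset α) : Set α) = 4) ∨
      (∃ a ∈ G, ∃ a' ∈ G, a ≠ a' ∧ M.eRk (((G.erase a).erase a' : Finset α) : Set α) = 4 ∧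
        a ∉ M.closure (((G.erase a).erase a' : Finset α) : Set α) ∧
        a' ∉ M.closure (((G.erase a).erase a' : Finset α) : Set α)) := by
  obtain ⟨a, haG, a', ha'G, hle⟩ := h
  have h3 := eRk_erase_erase_ge (M := M) (a := a) (a' := a') hr
  obtain ⟨k, hk, -⟩ := eRk_eq_nat M ((G.erase a).erase a')
  rw [hk] at hle h3
  have hk5 : k + 1 ≤ 5 := by exact_mod_cast hle
  have hk3 : 3 ≤ k := by exact_mod_cast h3
  -- the rank of `G ∖ a` is `4` or `5`
  have hGa : (4 : ℕ∞) ≤ M.eRk ((G.erase a : Finset α) : Set α) := by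
    have h1 := M.eRk_insert_le_add_one a (((G.erase a) : Finset α) : Set α)
    rw [← Finset.coe_insert, Finset.insert_erase haG, hr] at h1
    obtain ⟨j, hj, -⟩ := eRk_eq_nat M (G.erase a)
    rw [hj] at h1 ⊢
    have h5 : ((5 : ℕ) : ℕ∞) ≤ ((j + 1 : ℕ) : ℕ∞) := by push_cast; exact h1
    have := (Nat.cast_le (α := ℕ∞)).1 h5
    exact_mod_cast (by omega : 4 ≤ j)
  by_cases hne : a = a'
  · -- one point
    subst hne
    left
    refine ⟨a, haG, le_antisymm ?_ hGa⟩
    rw [Finset.erase_idem] at hk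
    calc M.eRk ((G.erase a : Finset α) : Set α) = (k : ℕ∞) := hk
      _ ≤ 4 := by exact_mod_cast (by omega : k ≤ 4)
  · have ha'Ga : a' ∈ G.erase a := Finset.mem_erase.2 ⟨fun h => hne h.symm, ha'G⟩
    have haτ : a ∉ (G.erase a).erase a' := fun h => (Finset.mem_erase.1 (Finset.mem_of_mem_erase h)).1 rfl
    have ha'τ : a' ∉ (G.erase a).erase a' := fun h => (Finset.mem_erase.1 h).1 rfl
    have hins : insert a' ((G.erase a).erase a') = G.erase a := Finset.insert_erase ha'Ga
    by_cases hk4 : k = 4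
    · -- `ρ(τ) = 4`
      by_cases ha'cl : a' ∈ M.closure (((G.erase a).erase a' : Finset α) : Set α)
      · left
        refine ⟨a, haG, ?_⟩
        rw [← hins, Finset.coe_insert, ← M.eRk_closure_eq (insert a' _),
          Matroid.closure_insert_eq_of_mem_closure ha'cl, M.eRk_closure_eq, hk, hk4]
        rfl
      · by_cases hacl : a ∈ M.closure (((G.erase a).erase a' : Finset α) : Set α)
        · left
          refine ⟨a', ha'G, ?_⟩
          have hins' : insert a ((G.erase a).erase a') = G.erase a' := by
            rw [Finset.erase_right_comm, Finset.insert_erase (Finset.mem_erase.2 ⟨hne, haG⟩)]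
          rw [← hins', Finset.coe_insert, ← M.eRk_closure_eq (insert a _),
            Matroid.closure_insert_eq_of_mem_closure hacl, M.eRk_closure_eq, hk, hk4]
          rfl
        · right
          exact ⟨a, haG, a', ha'G, hne, by rw [hk, hk4]; rfl, hacl, ha'cl⟩
    · -- `ρ(τ) = 3`: `G ∖ a` has rank `4`
      left
      refine ⟨a, haG, le_antisymm ?_ hGa⟩
      have h1 := M.eRk_insert_le_add_one a' (((G.erase a).erase a' : Finset α) : Set α)
      rw [← Finset.coe_insert, hins, hk] at h1
      calc M.eRk ((G.erase a : Finset α) : Set α) ≤ (k : ℕ∞) + 1 := h1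
        _ = ((k + 1 : ℕ) : ℕ∞) := by push_cast; rfl
        _ ≤ 4 := by exact_mod_cast (by omega : k + 1 ≤ 4)

/-- **`SevenFiveLayers` from the three corners of `t = 4` and the low layers.** -/
theorem sevenFiveLayers_of_corners (h1 : SevenFiveCornerOne) (h2 : SevenFiveCornerTwo) (h3 : SevenFiveCornerThree)
    (hlow : SevenFiveLowLayers) : SevenFiveLayers := by
  intro β _ M _ G hs hG hF
  refine ⟨(hlow M G hs hG hF).1, (hlow M G hs hG hF).2, ?_⟩
  have hGg : G ⊆ gr M := (mem_flatsQ.1 hG).1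
  have hr : M.eRk (G : Set β) = 5 := by
    have := (mem_flatsQ.1 hG).2.2
    exact_mod_cast this
  by_cases hH : HypPlusLeTwo M G 5
  · rcases hypPlusLeTwo_cases hr hH with ⟨a, haG, hra⟩ | ⟨a, haG, a', ha'G, hne, hrτ, hacl, ha'cl⟩
    · -- corner (i)
      have ha : a ∈ gr M := hGg haG
      have hacl : a ∉ M.closure ((G.erase a : Finset β) : Set β) :=
        notMem_closure_erase_of_eRk_lt ha (by rw [hra, hr]; norm_num)
      have key := Jq_five_four_hyp_add_one_eq (M := M) (H := G.erase a) ha (Finset.notMem_erase a G) hacl hra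
      rw [Finset.insert_erase haG] at key
      rw [key]
      exact h1 M (G.erase a) hs ((Finset.erase_subset a G).trans hGg) hra
    · -- corner (ii)
      have ha : a ∈ gr M := hGg haG
      have ha' : a' ∈ gr M := hGg ha'G
      have haτ : a ∉ (G.erase a).erase a' := fun h => (Finset.mem_erase.1 (Finset.mem_of_mem_erase h)).1 rfl
      have ha'τ : a' ∉ (G.erase a).erase a' := fun h => (Finset.mem_erase.1 h).1 rfl
      have hins : insert a (insert a' ((G.erase a).erase a')) = G := by
        rw [Finset.insert_erase (Finset.mem_erase.2 ⟨fun h => hne h.symm, ha'G⟩), Finset.insert_erase haG]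
      have hτg : (G.erase a).erase a' ⊆ gr M :=
        ((Finset.erase_subset _ _).trans (Finset.erase_subset _ _)).trans hGg
      have hrτ' : M.eRk (((G.erase a).erase a' : Finset β) : Set β) = ((4 : ℕ) : ℕ∞) := by
        rw [hrτ]; rfl
      have hrG : M.eRk ((insert a (insert a' ((G.erase a).erase a')) : Finset β) : Set β) = ((4 : ℕ) : ℕ∞) + 1 := by
        rw [hins, hr]; rfl
      have key := Jq_hyp_add_two_ge_profile (M := M) (q := 4) (t := 4) ha ha' hne haτ ha'τ hacl ha'cl hrτ' hrG
        (by norm_num) (by norm_num)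
      rw [hins] at key
      refine le_trans ?_ key
      exact h2 M ((G.erase a).erase a') a a' hs hτg ha ha' hne haτ ha'τ hacl ha'cl hrτ (by rw [hins, hr])
  · exact h3 M G hs hG hF hH

/-- **C-025 at `(7, 5)` on every finite matroid from the three corners and the low layers.** -/
theorem rls_seven_five_of_corners {α : Type} [DecidableEq α] (h1 : SevenFiveCornerOne) (h2 : SevenFiveCornerTwo)
    (h3 : SevenFiveCornerThree) (hlow : SevenFiveLowLayers) (M : Matroid α) [M.Finite] : RLS M 7 5 :=
  rls_seven_five_of_layers (sevenFiveLayers_of_corners h1 h2 h3 hlow) M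

end PercRepro.GenQ
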